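/-
Origin: expansion seat `planner-pub-hodgecm-landherr-g10-0`, handover #1 2026-08-18T09:40:41Z (`HOME/pub-hodgecm-landherr-g10/lean/LandherrG10/HermSpace3LocalGlobal.lean`, md5 68e0c644, 536 lines);
landed by the gen-7 packager in gate run 27 as `HodgeCM/Proofs/LandherrLocalGlobal.lean` (verbatim).
-/
/-
Copyright: pub-hodgecm formalisation cell (harness21, 2026). New file (not vendored).
Origin: HOME/pub-hodgecm-landherr-g10/lean/LandherrG10/HermSpace3LocalGlobal.lean — session
planner-pub-hodgecm-landherr-g10-0 (unit pub-hodgecm-landherr-g10, EXPANSION part (c) `Lemma33bLandherr`, gen 10).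
Intended final place: `HodgeCM/Proofs/LandherrLocalGlobal.lean` (additive leaf; imports only the landed
`HodgeCM.Proofs.LandherrSimilitude` (run 26) and `HodgeCM.Literature.QuadraticCharacterCM` (run 25); nothing in the
package depends on it).
-/
import Summits.HodgeConjecture.HodgeCM.Proofs.LandherrSimilitude
import Summits.HodgeConjecture.HodgeCM.Literature.QuadraticCharacterCM

set_option autoImplicit false

/-!
# Landherr's theorem with LOCAL invariants: the hermitian 3-spaces of PerL are classified by an odd finite set of places

`HodgeCM.HermSpace3.classification` (`Proofs/LandherrHermSpace3.lean`, gate run 25) classifies PerL's hermitian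
3-spaces `(V₃,h)` over the CM field `L` — signature `(2,1)` at the place of `ι₁`, `(3,0)` at the other real places of
`L₀ = L⁺` — by the GLOBAL invariant `[det h] ∈ L₀^× / N_{L/L₀}(L^×)`.  This file computes that norm class group by
its LOCAL components, as Landherr's theorem is usually stated (Landherr 1936; Shimura, Doc. Math. 13 (2008) Thm 2.2;
Scharlau, *Quadratic and Hermitian Forms*, Ch. 10 Ex. 1.6 (ii)–(iii)), using only KERNEL theorems of the vendored
H21 cone: Hilbert's reciprocity law (O'Meara 71:18, `Literature.NumberTheory.QuadraticForms.hilbertReciprocity_holds`),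
Hasse's norm theorem for quadratic extensions (O'Meara 65:23, `Literature.NumberTheory.Automorphic.
hilbertSymbol_eq_one_of_forall_completions_holds`) and the existence of elements with prescribed local Hilbert
symbols (O'Meara 71:19, `Literature.NumberTheory.QuadraticForms.exists_hilbertSymbol_eq_neg_one_iff_of_hilbertReciprocity`).

Write `L = L₀(√a)` with `a = cmGenerator L ∈ L₀` totally negative (`Literature/QuadraticCharacterCM.lean`).  For
`d ∈ L₀^×` and a finite place `v` of `L₀` put `ε_v(d) := (d, a)_v ∈ {±1}` (the Hilbert symbol in the completion
`(L₀)_v`; `HermSpace3.localSymbol`): `ε_v(d) = 1` iff `d` is a norm from `L ⊗_{L₀} (L₀)_v = (L₀)_v(√a)`, and for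
`d = det h` this is Landherr's local invariant of `(V₃,h)` at `v` — `(V₃,h)_v ≅ ⟨1,1,1⟩_v` iff `ε_v(det h) = 1`
(Jacobowitz).  Let `T(V) := {v finite : ε_v(det h) = -1}` (`HermSpace3.negPlaces`).

* §1–§2: the real places of `L₀` versus the complex embeddings of `L` (Mathlib `IsCMField.equivInfinitePlace`); an
  admissible discriminant is negative at EXACTLY ONE real place of `L₀`, the one under `ι₁`
  (`AdmissibleDisc.embedding_neg_iff`); local symbols are multiplicative and trivial on norms `z·σ(z)`.
* §3 **Oddness** (`HermSpace3.odd_ncard_negPlaces`, `HermSpace3.negPlaces_nonempty`): `T(V)` is a finite set of ODD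
  cardinality — Hilbert reciprocity, the archimedean symbols `(det h, a)_w` being `-1` at the place under `ι₁` alone.
  In particular `T(V) ≠ ∅`: EVERY `(V₃,h)` of PerL's signatures has a finite place of `L₀`, non-split in `L`, at which
  `det h` is not a local norm (`HermSpace3.exists_det_not_localNorm`); there is no "everywhere locally trivial" space.
  (This settles the cell's precision note GAPS `adv3g20-X1` as a kernel theorem.)
* §4 **Local classification** (`HermSpace3.isometric_iff_negPlaces_eq`): `(V₃,h) ≅ (V₃',h')` iff `T(V) = T(V')` —
  "if" by Hasse's norm theorem applied to `det h / det h'`, whose local symbols are all `1` (finite places by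
  hypothesis, real places because both discriminants have the signs forced by the signatures), "only if" by §2.
* §5 **Realisation** (`HermSpace3.exists_negPlaces_eq`): every finite set `S` of finite places of `L₀` of odd
  cardinality, at each of which `a` is a local non-square (i.e. `v` does not split in `L`), is `T(V)` for some
  `(V₃,h)` — O'Meara 71:19 with the archimedean symbol prescribed at the place under `ι₁`, then
  `HermSpace3.exists_det_eq`; and conversely `T(V)` only contains such places (`not_isSquare_of_mem_negPlaces`).
* §6 the classification collected (`HermSpace3.localGlobal_classification`): `(V₃,h) ↦ T(V)` is a bijection from the
  isometry classes of PerL's hermitian 3-spaces onto the odd finite sets of finite places of `L₀` non-split in `L`;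
  and the invariant does not depend on the choice of `a` (`localSymbol_eq_of_generator`).

Pure proof over landed files: nothing is cited or posited here; every closure is the standard trio.
-/

noncomputable section

open scoped Matrix
open NumberField NumberField.InfinitePlace IsDedekindDomain
open Literature.NumberTheory.QuadraticForms
open Literature.AlgebraicGeometry.ShimuraVarieties

namespace HodgeCM

namespace HermSpace3

variable {L : CMField} {ι₁ : L →+* ℂ}

/-! ## §1. Real places of `L₀` and the sign of an admissible discriminant -/

/-- The real place of `L₀ = L⁺` lying under the distinguished complex embedding `ι₁` of `L`. -/
abbrev basePlace (ι₁ : L →+* ℂ) : InfinitePlace (maximalRealSubfield L) :=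
  IsCMField.equivInfinitePlace L (InfinitePlace.mk ι₁)

/-- (Ported verbatim from the HodgeCMPerL package; no docstring in the source.) -/
theorem basePlace_eq_comap (ι₁ : L →+* ℂ) :
    basePlace ι₁ = (InfinitePlace.mk ι₁).comap (algebraMap (maximalRealSubfield L) L) := rfl

/-- `L₀` is totally real: every infinite place is real. -/
theorem isReal_infinitePlace (w : InfinitePlace (maximalRealSubfield L)) : w.IsReal :=
  IsTotallyReal.isReal w

/-- The real embedding of `L₀` at the place under `W` is `Re ∘ W.embedding` on `L₀`. -/
theorem embedding_of_isReal_eq_re (W : InfinitePlace L)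
    (hw : (IsCMField.equivInfinitePlace L W).IsReal) (x : maximalRealSubfield L) :
    embedding_of_isReal hw x = (W.embedding (x : L)).re := by
  have h1 : ((embedding_of_isReal hw x : ℝ) : ℂ) = (IsCMField.equivInfinitePlace L W).embedding x :=
    embedding_of_isReal_apply hw x
  have h2 : (IsCMField.equivInfinitePlace L W).embedding =
      W.embedding.comp (algebraMap (maximalRealSubfield L) L) :=
    comap_embedding_of_isReal _ hw
  rw [h2, RingHom.comp_apply] at h1
  have h3 := congrArg Complex.re h1
  rw [Complex.ofReal_re] at h3
  rw [h3]
  rfl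

/-- **An admissible discriminant is negative at exactly one real place of `L₀`: the place under `ι₁`.** -/
theorem AdmissibleDisc.embedding_neg_iff {d : maximalRealSubfield L} (hd : AdmissibleDisc L ι₁ (d : L))
    (w : InfinitePlace (maximalRealSubfield L)) (hw : w.IsReal) :
    embedding_of_isReal hw d < 0 ↔ w = basePlace ι₁ := by
  obtain ⟨W, rfl⟩ := (IsCMField.equivInfinitePlace L).surjective w
  rw [embedding_of_isReal_eq_re W hw]
  by_cases hW : W = InfinitePlace.mk ι₁
  · subst hW
    rw [LandherrRankN.re_embedding_mk]
    exact ⟨fun _ => rfl, fun _ => hd.2.1⟩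
  · have hne : InfinitePlace.mk W.embedding ≠ InfinitePlace.mk ι₁ := by rwa [mk_embedding]
    have hpos := hd.2.2 W.embedding hne
    exact ⟨fun h => absurd h (not_lt.2 hpos.le), fun h => absurd ((IsCMField.equivInfinitePlace L).injective h) hW⟩

/-- Off the base place an admissible discriminant is positive. -/
theorem AdmissibleDisc.embedding_pos_iff {d : maximalRealSubfield L} (hd : AdmissibleDisc L ι₁ (d : L))
    (w : InfinitePlace (maximalRealSubfield L)) (hw : w.IsReal) :
    0 < embedding_of_isReal hw d ↔ w ≠ basePlace ι₁ := by
  have hd0 : embedding_of_isReal hw d ≠ 0 := by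
    refine (_root_.map_ne_zero _).2 fun h => hd.ne_zero ?_
    rw [h]; rfl
  rw [Ne, ← hd.embedding_neg_iff w hw, not_lt]
  exact ⟨fun h => h.le, fun h => lt_of_le_of_ne h hd0.symm⟩

/-! ## §2. Landherr's local invariant `ε_v(d) = (d, a)_v` at a finite place of `L₀` -/

/-- `a = cmGenerator L` is non-zero. -/
theorem cmGenerator_ne_zero (L : CMField) : (cmGenerator L : maximalRealSubfield L) ≠ 0 := by
  intro h
  exact cmGenerator_not_isSquare L (by rw [h]; exact ⟨0, (mul_zero _).symm⟩)

/-- **Landherr's local invariant** of a discriminant `d ∈ L₀` at the finite place `v` of `L₀`: the Hilbert symbol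
`ε_v(d) = (d, a)_v ∈ {±1}` computed in the completion `(L₀)_v`, where `L = L₀(√a)`, `a = cmGenerator L`.  It is `1`
iff `d` is a norm from the quadratic algebra `(L₀)_v(√a) = L ⊗_{L₀} (L₀)_v` (`localSymbol_eq_one_iff`); for
`d = det h` it is `1` iff `(V₃,h) ⊗ (L₀)_v ≅ ⟨1,1,1⟩`. -/
def localSymbol (d : maximalRealSubfield L) (v : HeightOneSpectrum (𝓞 (maximalRealSubfield L))) : ℤ :=
  hilbertSymbol (v.adicCompletion (maximalRealSubfield L))
    (algebraMap (maximalRealSubfield L) _ d) (algebraMap (maximalRealSubfield L) _ (cmGenerator L))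

/-- The finite places of `L₀` at which the local invariant of `d` is `-1`. -/
def negPlaces (d : maximalRealSubfield L) : Set (HeightOneSpectrum (𝓞 (maximalRealSubfield L))) :=
  {v | localSymbol d v = -1}

/-- (Ported verbatim from the HodgeCMPerL package; no docstring in the source.) -/
theorem mem_negPlaces_iff (d : maximalRealSubfield L) (v : HeightOneSpectrum (𝓞 (maximalRealSubfield L))) :
    v ∈ negPlaces d ↔ localSymbol d v = -1 := Iff.rfl

/-- (Ported verbatim from the HodgeCMPerL package; no docstring in the source.) -/
theorem localSymbol_eq_one_or (d : maximalRealSubfield L) (v : HeightOneSpectrum (𝓞 (maximalRealSubfield L))) :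
    localSymbol d v = 1 ∨ localSymbol d v = -1 :=
  hilbertSymbol_eq_one_or_eq_neg_one _ _

/-- (Ported verbatim from the HodgeCMPerL package; no docstring in the source.) -/
theorem algebraMap_cmGenerator_ne_zero (v : HeightOneSpectrum (𝓞 (maximalRealSubfield L))) :
    algebraMap (maximalRealSubfield L) (v.adicCompletion (maximalRealSubfield L)) (cmGenerator L) ≠ 0 :=
  (_root_.map_ne_zero _).2 (cmGenerator_ne_zero L)

/-- `ε_v(d) = 1` iff `d` is a local norm: `x² - a y² = d` is soluble in `(L₀)_v` (O'Meara 63:10 / §65A, the cone's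
`hilbertSymbol_eq_one_iff_mem_quadraticNormSubgroup`). -/
theorem localSymbol_eq_one_iff {d : maximalRealSubfield L} (hd : d ≠ 0)
    (v : HeightOneSpectrum (𝓞 (maximalRealSubfield L))) :
    localSymbol d v = 1 ↔ ∃ x y : v.adicCompletion (maximalRealSubfield L),
      x ^ 2 - algebraMap (maximalRealSubfield L) _ (cmGenerator L) * y ^ 2 =
        algebraMap (maximalRealSubfield L) _ d := by
  haveI : CharZero (v.adicCompletion (maximalRealSubfield L)) :=
    charZero_of_injective_algebraMap (algebraMap (maximalRealSubfield L) _).injective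
  have hd' : algebraMap (maximalRealSubfield L) (v.adicCompletion (maximalRealSubfield L)) d ≠ 0 :=
    (_root_.map_ne_zero _).2 hd
  have h := hilbertSymbol_eq_one_iff_mem_quadraticNormSubgroup (algebraMap_cmGenerator_ne_zero v) (Units.mk0 _ hd')
  rw [Units.val_mk0] at h
  exact h.trans mem_quadraticNormSubgroup_iff

/-- `ε_v(d) = -1` iff `d` is NOT a local norm at `v`. -/
theorem localSymbol_eq_neg_one_iff {d : maximalRealSubfield L} (hd : d ≠ 0)
    (v : HeightOneSpectrum (𝓞 (maximalRealSubfield L))) :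
    localSymbol d v = -1 ↔ ¬ ∃ x y : v.adicCompletion (maximalRealSubfield L),
      x ^ 2 - algebraMap (maximalRealSubfield L) _ (cmGenerator L) * y ^ 2 =
        algebraMap (maximalRealSubfield L) _ d := by
  rw [← localSymbol_eq_one_iff hd]
  rcases localSymbol_eq_one_or d v with h | h <;> simp [h]

/-- The local invariant is multiplicative (O'Meara 63:13a via the cone's `hilbertSymbol_adicCompletion_mul_left`). -/
theorem localSymbol_mul {d d' : maximalRealSubfield L} (hd : d ≠ 0) (hd' : d' ≠ 0)
    (v : HeightOneSpectrum (𝓞 (maximalRealSubfield L))) :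
    localSymbol (d * d') v = localSymbol d v * localSymbol d' v := by
  unfold localSymbol
  rw [map_mul]
  exact hilbertSymbol_adicCompletion_mul_left (maximalRealSubfield L) v ((_root_.map_ne_zero _).2 hd)
    ((_root_.map_ne_zero _).2 hd') (algebraMap_cmGenerator_ne_zero v)

/-- `x² - a y²` (with `x y ∈ L₀`, non-zero) has all local invariants `1`. -/
theorem localSymbol_sq_sub_mul_sq {x y : maximalRealSubfield L} (h : x ^ 2 - cmGenerator L * y ^ 2 ≠ 0)
    (v : HeightOneSpectrum (𝓞 (maximalRealSubfield L))) :
    localSymbol (x ^ 2 - cmGenerator L * y ^ 2) v = 1 :=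
  (localSymbol_eq_one_iff h v).2 ⟨algebraMap _ _ x, algebraMap _ _ y, by simp [map_sub, map_mul, map_pow]⟩

/-- The relative norm `N_{L/L₀}(z) = z·σ(z)` as an element of `L₀`. -/
def relNorm (z : L) : maximalRealSubfield L :=
  ⟨z * conjRingHomK L z, Lemma33bLandherrProof.mem_maximalRealSubfield L
    (by rw [map_mul, conjRingHomK_conjRingHomK, mul_comm])⟩

/-- (Ported verbatim from the HodgeCMPerL package; no docstring in the source.) -/
@[simp] theorem coe_relNorm (z : L) : (relNorm z : L) = z * conjRingHomK L z := rfl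

/-- (Ported verbatim from the HodgeCMPerL package; no docstring in the source.) -/
theorem relNorm_ne_zero {z : L} (hz : z ≠ 0) : relNorm z ≠ 0 := by
  intro h
  have h' : z * conjRingHomK L z = 0 := by rw [← coe_relNorm, h]; rfl
  exact (mul_ne_zero hz ((_root_.map_ne_zero _).2 hz)) h'

/-- **Norms are `x² - a y²`.**  `z·σ(z) = x² - a y²` with `x = (z + σz)/2`, `y = (z - σz)/(2α)` in `L₀`, where
`α² = a`, `σ(α) = -α`. -/
theorem relNorm_eq_sq_sub_mul_sq (z : L) :
    ∃ x y : maximalRealSubfield L, relNorm z = x ^ 2 - cmGenerator L * y ^ 2 := by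
  obtain ⟨α, hα0, hα2, hαc⟩ := cmGenerator_exists_sqrt L
  have hαc' : conjRingHomK L α = -α := by rw [conjRingHomK_apply, hαc]
  have h2 : (2 : L) ≠ 0 := two_ne_zero
  have hx : conjRingHomK L ((z + conjRingHomK L z) / 2) = (z + conjRingHomK L z) / 2 := by
    rw [map_div₀, map_add, conjRingHomK_conjRingHomK, map_ofNat, add_comm]
  have hy : conjRingHomK L ((z - conjRingHomK L z) / (2 * α)) = (z - conjRingHomK L z) / (2 * α) := by
    rw [map_div₀, map_sub, conjRingHomK_conjRingHomK, map_mul, map_ofNat, hαc', ← neg_sub z, mul_neg, neg_div_neg_eq]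
  refine ⟨⟨_, Lemma33bLandherrProof.mem_maximalRealSubfield L hx⟩,
    ⟨_, Lemma33bLandherrProof.mem_maximalRealSubfield L hy⟩, Subtype.ext ?_⟩
  change z * conjRingHomK L z =
    ((z + conjRingHomK L z) / 2) ^ 2 - (cmGenerator L : L) * ((z - conjRingHomK L z) / (2 * α)) ^ 2
  rw [← hα2]
  field_simp
  ring

/-- Conversely `x² - a y² = N(x + yα)`. -/
theorem sq_sub_mul_sq_eq_relNorm (x y : maximalRealSubfield L) :
    ∃ z : L, x ^ 2 - cmGenerator L * y ^ 2 = relNorm z := by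
  obtain ⟨α, -, hα2, hαc⟩ := cmGenerator_exists_sqrt L
  have hαc' : conjRingHomK L α = -α := by rw [conjRingHomK_apply, hαc]
  refine ⟨x + y * α, Subtype.ext ?_⟩
  change ((x : L)) ^ 2 - (cmGenerator L : L) * (y : L) ^ 2 = (x + y * α) * conjRingHomK L (x + y * α)
  rw [map_add, map_mul, Lemma33bLandherrProof.conj_coe_maximalRealSubfield L x,
    Lemma33bLandherrProof.conj_coe_maximalRealSubfield L y, hαc', ← hα2]
  ring

/-- **Norms have trivial local invariants**: `ε_v(d · zσ(z)) = ε_v(d)`. -/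
theorem localSymbol_mul_relNorm {d : maximalRealSubfield L} (hd : d ≠ 0) {z : L} (hz : z ≠ 0)
    (v : HeightOneSpectrum (𝓞 (maximalRealSubfield L))) :
    localSymbol (d * relNorm z) v = localSymbol d v := by
  obtain ⟨x, y, hxy⟩ := relNorm_eq_sq_sub_mul_sq z
  rw [localSymbol_mul hd (relNorm_ne_zero hz), hxy, localSymbol_sq_sub_mul_sq (hxy ▸ relNorm_ne_zero hz), mul_one]

/-- (Ported verbatim from the HodgeCMPerL package; no docstring in the source.) -/
theorem negPlaces_mul_relNorm {d : maximalRealSubfield L} (hd : d ≠ 0) {z : L} (hz : z ≠ 0) :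
    negPlaces (d * relNorm z) = negPlaces d := by
  ext v
  rw [mem_negPlaces_iff, mem_negPlaces_iff, localSymbol_mul_relNorm hd hz]

/-- A place in `negPlaces d` does not split in `L`: `a` is not a square in `(L₀)_v` (as `(d, c²)_v = 1`). -/
theorem not_isSquare_of_mem_negPlaces {d : maximalRealSubfield L} {v : HeightOneSpectrum (𝓞 (maximalRealSubfield L))}
    (hv : v ∈ negPlaces d) :
    ¬ IsSquare (algebraMap (maximalRealSubfield L) (v.adicCompletion (maximalRealSubfield L)) (cmGenerator L)) := by
  intro hsq
  have h1 : localSymbol d v = 1 := by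
    unfold localSymbol
    rw [hilbertSymbol_comm]
    exact hilbertSymbol_eq_one_of_isSquare hsq (algebraMap_cmGenerator_ne_zero v) _
  rw [mem_negPlaces_iff, h1] at hv
  norm_num at hv

/-! ## §3. Oddness: the number of places with `ε_v(det h) = -1` is odd (Hilbert reciprocity) -/

/-- (Ported verbatim from the HodgeCMPerL package; no docstring in the source.) -/
theorem ne_zero_of_coe_ne_zero {d : maximalRealSubfield L} (h : (d : L) ≠ 0) : d ≠ 0 := by
  rintro rfl
  exact h rfl

/-- Finiteness of `negPlaces d` (the finiteness half of O'Meara 71:18). -/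
theorem negPlaces_finite {d : maximalRealSubfield L} (hd : d ≠ 0) : (negPlaces d).Finite :=
  (hilbertReciprocity_holds (maximalRealSubfield L) d (cmGenerator L) hd (cmGenerator_ne_zero L)).1

/-- The archimedean symbols of an admissible discriminant: `(d, a)_w = -1` exactly at the base place (`a` is totally
negative, and `d` is negative there and positive at the other real places). -/
theorem AdmissibleDisc.setOf_infinitePlace_eq {d : maximalRealSubfield L} (hd : AdmissibleDisc L ι₁ (d : L)) :
    {w : InfinitePlace (maximalRealSubfield L) |
        hilbertSymbol w.Completion (algebraMap (maximalRealSubfield L) _ d)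
          (algebraMap (maximalRealSubfield L) _ (cmGenerator L)) = -1} = {basePlace ι₁} := by
  ext w
  rw [Set.mem_setOf_eq, Set.mem_singleton_iff,
    hilbertSymbol_completion_eq_neg_one_iff_of_embedding_neg (isReal_infinitePlace w)
      (ne_zero_of_coe_ne_zero hd.ne_zero) (cmGenerator_neg L w _)]
  exact hd.embedding_neg_iff w _

/-- **Oddness.**  For an admissible discriminant `d` the set of finite places `v` of `L₀` with `(d, a)_v = -1` has odd
cardinality: by Hilbert reciprocity (O'Meara 71:18) the total number of places with symbol `-1` is even, and among the
infinite places there is exactly one, the base place. -/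
theorem AdmissibleDisc.odd_ncard_negPlaces {d : maximalRealSubfield L} (hd : AdmissibleDisc L ι₁ (d : L)) :
    Odd (negPlaces d).ncard := by
  obtain ⟨-, heven⟩ := hilbertReciprocity_holds (maximalRealSubfield L) d (cmGenerator L)
    (ne_zero_of_coe_ne_zero hd.ne_zero) (cmGenerator_ne_zero L)
  rw [hd.setOf_infinitePlace_eq, Set.ncard_singleton, Nat.even_add_one] at heven
  exact Nat.not_even_iff_odd.1 heven

/-- (Ported verbatim from the HodgeCMPerL package; no docstring in the source.) -/
theorem AdmissibleDisc.negPlaces_nonempty {d : maximalRealSubfield L} (hd : AdmissibleDisc L ι₁ (d : L)) :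
    (negPlaces d).Nonempty :=
  Set.nonempty_of_ncard_ne_zero hd.odd_ncard_negPlaces.pos.ne'

/-! ### For a hermitian 3-space -/

/-- The discriminant `det h ∈ L₀` of `(V₃,h)`, as an element of the maximal real subfield. -/
def discr (V : HermSpace3 L ι₁) : maximalRealSubfield L :=
  ⟨V.Hm.det, Lemma33bLandherrProof.mem_maximalRealSubfield L V.det_isReal⟩

/-- (Ported verbatim from the HodgeCMPerL package; no docstring in the source.) -/
@[simp] theorem coe_discr (V : HermSpace3 L ι₁) : (V.discr : L) = V.Hm.det := rfl

/-- (Ported verbatim from the HodgeCMPerL package; no docstring in the source.) -/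
theorem admissibleDisc_discr (V : HermSpace3 L ι₁) : AdmissibleDisc L ι₁ (V.discr : L) :=
  V.admissibleDisc_det

/-- (Ported verbatim from the HodgeCMPerL package; no docstring in the source.) -/
theorem discr_ne_zero (V : HermSpace3 L ι₁) : V.discr ≠ 0 :=
  ne_zero_of_coe_ne_zero V.det_ne_zero

/-- `T(V)`: the finite places of `L₀` at which `(V₃,h)` has local invariant `ε_v(det h) = -1`. -/
theorem negPlaces_discr_finite (V : HermSpace3 L ι₁) : (negPlaces V.discr).Finite :=
  negPlaces_finite V.discr_ne_zero

/-- **`|T(V)|` is odd** (GAPS adv3g20-X1 as a theorem: the finite local invariants of a hermitian 3-space of PerL's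
signatures are not freely prescribable — an odd number of them, in particular at least one, is `-1`). -/
theorem odd_ncard_negPlaces (V : HermSpace3 L ι₁) : Odd (negPlaces V.discr).ncard :=
  V.admissibleDisc_discr.odd_ncard_negPlaces

/-- (Ported verbatim from the HodgeCMPerL package; no docstring in the source.) -/
theorem negPlaces_nonempty (V : HermSpace3 L ι₁) : (negPlaces V.discr).Nonempty :=
  V.admissibleDisc_discr.negPlaces_nonempty

/-- **Every `(V₃,h)` of PerL's signatures has a finite place of `L₀`, non-split in `L`, at which `det h` is not a local
norm** — there is no hermitian 3-space of these signatures that is locally trivial at all finite places. -/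
theorem exists_det_not_localNorm (V : HermSpace3 L ι₁) :
    ∃ v : HeightOneSpectrum (𝓞 (maximalRealSubfield L)),
      ¬ IsSquare (algebraMap (maximalRealSubfield L) (v.adicCompletion (maximalRealSubfield L)) (cmGenerator L)) ∧
      ¬ ∃ x y : v.adicCompletion (maximalRealSubfield L),
        x ^ 2 - algebraMap (maximalRealSubfield L) _ (cmGenerator L) * y ^ 2 =
          algebraMap (maximalRealSubfield L) _ V.discr := by
  obtain ⟨v, hv⟩ := V.negPlaces_nonempty
  exact ⟨v, not_isSquare_of_mem_negPlaces hv, (localSymbol_eq_neg_one_iff V.discr_ne_zero v).1 hv⟩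

/-! ## §4. The local classification: `(V₃,h) ≅ (V₃',h')` iff `T(V) = T(V')` (Hasse's norm theorem) -/

/-- Two `±1`-valued invariants with the same `-1`-locus are equal. -/
theorem localSymbol_eq_of_neg_iff {d d' : maximalRealSubfield L} {v : HeightOneSpectrum (𝓞 (maximalRealSubfield L))}
    (h : localSymbol d v = -1 ↔ localSymbol d' v = -1) : localSymbol d v = localSymbol d' v := by
  rcases localSymbol_eq_one_or d v with h1 | h1 <;> rcases localSymbol_eq_one_or d' v with h2 | h2 <;>
    simp only [h1, h2] at h ⊢ <;> norm_num at h


-- port_pkg: scope closed for this part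
end HermSpace3
end HodgeCM
end
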